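import Literature.Geometry.Riemannian.CanonicalNeighbourhoodTheorem
import Literature.Geometry.Riemannian.PinchingEstimatesReduction6
import Literature.Geometry.Riemannian.RicciFlowPICProofs
import HarnessLib

/-!
# The a priori assumptions of the smooth solution (Chen–Zhu 2006, §5, p. 26): status of the discharge
(topic `Geometry/Riemannian`)

Companion ("Proofs") file of `CanonicalNeighbourhoodTheorem.lean` for the named fact
`Literature.Geometry.Riemannian.chenZhu_aprioriAssumptions_smoothSolution`
(`CanonicalNeighbourhoods.lean`; B.-L. Chen, X.-P. Zhu, J. Differential Geom. 74 (2006),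
arXiv:math/0504478, §5, p. 26: "It follows from Lemma 2.1 and Theorem 4.1 that the a priori
assumptions above hold for the smooth solution on `[0, T₀)`"). The printed sentence is the theorem
`chenZhu_aprioriAssumptions_smoothSolution_of_canonicalNeighbourhoodTheorem'`
(`CanonicalNeighbourhoodTheorem.lean`), whose four hypotheses are Theorem 4.1 in its §5 form
(`chenZhu_canonicalNeighbourhoodTheorem`), Perelman's no local collapsing theorem I
(`perelman_noLocalCollapsing`), Lemma 2.1 (`hamilton_chenZhu_pinching`) and the preservation of
positive isotropic curvature (`ricciFlow_preserves_positiveIsotropicCurvature`, Hamilton 1997,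
Thm. B1.2). The last two are reduced in the tree, by theorems only, to Hamilton's maximum
principle for systems applied to the curvature ODE of the Ricci flow
(`hamilton_maximumPrinciple_curvatureODE`, `HamiltonCurvatureODE.lean`; Hamilton 1986, §4,
Thm. 4.3): `hamilton_chenZhu_pinching_of_maximumPrinciple` (`PinchingEstimatesReduction6.lean`,
the whole of Hamilton 1997, §2 being proved) and
`ricciFlow_preserves_positiveIsotropicCurvature_of_maximumPrinciple` (`RicciFlowPICProofs.lean`).
This file records the composition:

* PROVED `chenZhu_aprioriAssumptions_smoothSolution_of_maximumPrinciple` — Theorem 4.1 (§5 form),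
  Perelman's no local collapsing theorem I and Hamilton's maximum principle for the curvature ODE
  imply `chenZhu_aprioriAssumptions_smoothSolution`.

So the fact stands on exactly three named facts of the tree — `chenZhu_canonicalNeighbourhoodTheorem`
(Chen–Zhu 2006, Thm. 4.1 with Thm. 3.8 and Prop. 3.6: Perelman's canonical neighbourhood
theorem for PIC 4-manifolds), `perelman_noLocalCollapsing` (Perelman 2002, Thm. 4.1) and
`hamilton_maximumPrinciple_curvatureODE` (Hamilton 1986, Thm. 4.3) — and its discharge is the
one-liner

  `theorem chenZhu_aprioriAssumptions_smoothSolution_holds : chenZhu_aprioriAssumptions_smoothSolution :=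
     chenZhu_aprioriAssumptions_smoothSolution_of_maximumPrinciple
       chenZhu_canonicalNeighbourhoodTheorem_holds perelman_noLocalCollapsing_holds
       hamilton_maximumPrinciple_curvatureODE_holds`

to be appended here once those three theorems exist. No definitions are introduced.

## References

* B.-L. Chen, X.-P. Zhu, *Ricci flow with surgery on four-manifolds with positive isotropic
  curvature*, J. Differential Geom. 74 (2006) 177–264 (arXiv:math/0504478): Lemma 2.1 (p. 4),
  Prop. 3.6 (p. 16), Thm. 3.8 (p. 17), Thm. 4.1 (p. 19), §5, p. 26. [ChenZhu2006]
* G. Perelman, *The entropy formula for the Ricci flow and its geometric applications*,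
  arXiv:math/0211159 (2002), §4, Thm. 4.1. [Perelman2002]
* R. S. Hamilton, *Four-manifolds with positive curvature operator*, J. Differential Geom. 24
  (1986) 153–179, §4, Thm. 4.3. [Hamilton1986]
* R. S. Hamilton, *Four-manifolds with positive isotropic curvature*, Comm. Anal. Geom. 5 (1997)
  1–92, §2, Thms. B1.1, B1.2, B2.3. [Hamilton1997]
-/

noncomputable section

namespace Literature.Geometry.Riemannian

/-- **"It follows from Lemma 2.1 and Theorem 4.1 that the a priori assumptions above hold for the
smooth solution on `[0, T₀)`"** (Chen–Zhu 2006, §5, arXiv p. 26), with Lemma 2.1 and Hamilton's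
Thm. B1.2 replaced by their common source in the tree, the maximum principle for the curvature
ODE (Hamilton 1986, Thm. 4.3): Theorem 4.1 (§5 form), Perelman's no local collapsing theorem I
and `hamilton_maximumPrinciple_curvatureODE` imply `chenZhu_aprioriAssumptions_smoothSolution`
(compose `chenZhu_aprioriAssumptions_smoothSolution_of_canonicalNeighbourhoodTheorem'` with
`hamilton_chenZhu_pinching_of_maximumPrinciple` and
`ricciFlow_preserves_positiveIsotropicCurvature_of_maximumPrinciple`).
[cite: ChenZhu2006, §5, p. 26] [cite: Hamilton1986, §4, Thm. 4.3 (p. 162)]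
[cite: Hamilton1997, §2.1, Thm. 1.2 (p. 7) and Thm. 1.1] -/
theorem chenZhu_aprioriAssumptions_smoothSolution_of_maximumPrinciple
    (h41 : chenZhu_canonicalNeighbourhoodTheorem.{0})
    (hP : perelman_noLocalCollapsing.{0, 0, 0})
    (hMP : hamilton_maximumPrinciple_curvatureODE.{0}) :
    chenZhu_aprioriAssumptions_smoothSolution :=
  chenZhu_aprioriAssumptions_smoothSolution_of_canonicalNeighbourhoodTheorem' h41 hP
    (hamilton_chenZhu_pinching_of_maximumPrinciple hMP)
    (ricciFlow_preserves_positiveIsotropicCurvature_of_maximumPrinciple hMP)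

end Literature.Geometry.Riemannian

end
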